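import Summits.BirchSwinnertonDyer.BirchSwinnertonDyer.Theorems.ByReductionTypeAtTwoMultTowerNS2LocalCyclotomicAction
import Summits.BirchSwinnertonDyer.BirchSwinnertonDyer.Theorems.ByReductionTypeAtTwoMultTowerSplitExactOddUnits
import HarnessLib

/-!
# Route `ByReductionTypeAtTwo`, crux `MultUpperHalfAtTwo` (item stmt-BirchSwinnertonDyer-19922), TOWER road, SPLIT rows:
# the EXACT order of the local tower kernel at a split multiplicative prime, part 5 (ODD `p`) — the local layer subgroups
# `H_m` through the cyclotomic character: `χ(σ)^{p−1} ≡ 1 (mod p^{m+1})`, and the CYCLOTOMIC ELEMENT `η_m ∈ F_m`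

HONEST FRAMING (cell `bsd-2adic`, run/shared/lean/pub/bsd-2adic/, seat `bsd-2adic-tower-1` GEN 27, HUMAN RULINGS
D-0036 / D-0054 / D-0074): TOOL theorems only (no definition, no named fact, no `sorry`); closes nothing by itself;
nothing booked; BSD is not proved by any of this. Second ODD-`p` module towards the `∀ p` named fact
`hSP = Greenberg1999.sec3_natCard_localTowerKerPrimary_splitMultiplicative_rat` (its `p = 2` clause is part 3,
`MultTowerSplitExact.sec3_natCard_localTowerKerPrimary_splitMultiplicative_two`). The odd-`p` norm group
`N(F_mˣ) = ⟨p⟩ · {w : w^{p−1} ≡ 1 (mod p^{m+1})}` (part 4 typed the right side with index `≤ p^m`) needs `p ∈ N(F_mˣ)`; the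
witness is the cyclotomic element `η_m = ∏_{t^{p−1} = 1} (1 − ζ^t)` (`ζ` a `p^{m+1}`-th root of unity, `t` over the
`(p−1)`-torsion of `(ℤ/p^{m+1})ˣ`) — the norm of `1 − ζ` from `ℚ_v(ζ_{p^{m+1}})` down to the layer `F_m` — whose norm to
`ℚ_v` is `Φ_{p^{m+1}}(1) = p`. This file (the odd-`p` analogue of GEN 9's BRICK 13a `…MultTowerNS2LocalCyclotomicAction.lean`):

* `pow_torsionOrder_eq_one_of_isOfFinOrder` — a torsion unit `ω` of `ℤ_p` has `ω^{torsionOrder p} = 1` (`torsionOrder p = p − 1`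
  for odd `p`, `Kato2004.torsionOrder_of_ne_two`): the tree's normalised logarithm `CyclotomicZp.ell` (`ell ω = 0 ↔ IsOfFinOrder ω`, `γ^{t·ell u} = u^t`);
* `exists_cyclotomicCharacter_eq_of_mem_layer` — for `σ ∈ H_m`: `χ(σ) = ω · w^{p^m}` with `ω` torsion (from
  `IsCyclotomic κ : ker κ = χ⁻¹(torsion)`, as at `p = 2`);
* `toZModPow_pow_cyclotomicCharacter_of_mem_layer` — **`χ(σ)^{p−1} ≡ 1 (mod p^{m+1})` for `σ ∈ H_m`, odd `p`**;
* `prod_one_sub_pow_mem_fixedField_layer` — **`η_m ∈ F_m`**: `σ ∈ H_m` permutes the factors `1 − ζ^t`, `t^{p−1} = 1`.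

The norm computation `N_{F_m/ℚ_v}(η_m) = p` and the identification `N(F_mˣ) = T_m` are part 6.

References: L. Washington, *Introduction to Cyclotomic Fields*, §13.1, Lemma 1.4 / Prop. 2.8 (`N(1 − ζ) = p`); J.-P. Serre,
*Local Fields* IV §4; cell memo NOTE-HNS2-KERNEL-GEN27.md (Stage D plan).
-/

set_option autoImplicit false
-- the Theorems namespace of this sub repeats the summit name by design (D-0017 nested layout: Summit.<S>.<Sub>)
set_option linter.dupNamespace false

noncomputable section

open scoped Classical

namespace Summit.BirchSwinnertonDyer.BirchSwinnertonDyer.Theorems.MultTowerSplitExact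

open NumberField IsDedekindDomain Field PadicInt Literature.NumberTheory.EllipticCurves
  Literature.NumberTheory.GaloisRepresentations Literature.NumberTheory.EllipticCurves.CyclotomicZp

variable {p : ℕ} [hp : Fact p.Prime] {κ : ZpExtension ℚ p}

/-! ### Torsion units of `ℤ_p` -/

/-- **A torsion unit `ω ∈ ℤ_pˣ` satisfies `ω^{torsionOrder p} = 1`** (`torsionOrder p = φ(p^{e₀}) = p − 1` for odd `p`, `2` for
`p = 2`): `ell ω = 0` (`CyclotomicZp.ell_eq_zero_iff`) and `γ_cyc^{t · ell u} = u^t` (`CyclotomicZp.cycPow_torsionOrder_mul_ell`).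
[cite: Washington1997, §5.1] [cite: Serre1973, Ch. II §3.2 Prop. 8] -/
theorem pow_torsionOrder_eq_one_of_isOfFinOrder {ω : ℤ_[p]ˣ} (hω : IsOfFinOrder ω) :
    ((ω : ℤ_[p])) ^ torsionOrder p = 1 := by
  have h0 : ell p ω = 0 := (ell_eq_zero_iff p ω).mpr hω
  have h := cycPow_torsionOrder_mul_ell p ω
  rw [h0, mul_zero, AddChar.map_zero_eq_one] at h
  exact h.symm

/-! ### `H_m` through the cyclotomic character (odd `p`) -/

/-- **`χ(σ) = ω · w^{p^m}` for `σ ∈ H_m`, `ω` a torsion unit** (any `p`): for the cyclotomic `ℤ_p`-extension `κ`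
(`ker κ = χ_p⁻¹(μ(ℤ_p))`), `v` a place and `σ` in the local layer subgroup `H_m = res_v⁻¹(κ⁻¹(p^m ℤ_p))`: writing
`κ(res σ) = p^m · κ(τ)`, the element `res σ · τ^{-p^m}` lies in `ker κ`, so its cyclotomic character is torsion; and
`χ_ℚ(res σ) = χ(σ)`. The `p`-general form of GEN 9's `exists_cyclotomicCharacter_eq_of_mem_localSubgroup_layerSubgroup`.
[cite: Washington1997, §13.1] -/
theorem exists_cyclotomicCharacter_eq_of_mem_layer (hκ : κ.IsCyclotomic) (v : HeightOneSpectrum (𝓞 ℚ)) {m : ℕ}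
    {σ : absoluteGaloisGroup (v.adicCompletion ℚ)} (hσ : σ ∈ localSubgroup (κ.layerSubgroup m) (v.adicCompletion ℚ)) :
    ∃ ω w : ℤ_[p]ˣ, IsOfFinOrder ω ∧ GaloisRep.cyclotomicCharacter (v.adicCompletion ℚ) p σ = ω * w ^ p ^ m := by
  rw [mem_localSubgroup_iff, ZpExtension.mem_layerSubgroup] at hσ
  obtain ⟨b, hb⟩ := hσ
  set ρ := resGal (K := ℚ) (v.adicCompletion ℚ) σ with hρ
  obtain ⟨τ, hτ⟩ := κ.surjective (Multiplicative.ofAdd b)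
  have hτ' : κ τ = Multiplicative.ofAdd b := hτ
  -- `ρ · (τ ^ p^m)⁻¹ ∈ ker κ`
  have hker : ρ * (τ ^ p ^ m)⁻¹ ∈ κ.kerSubgroup := by
    rw [ZpExtension.mem_kerSubgroup, map_mul, map_inv, map_pow, hτ']
    apply Multiplicative.toAdd.injective
    rw [toAdd_mul, toAdd_inv, toAdd_pow, toAdd_ofAdd, hb, toAdd_one, nsmul_eq_mul]
    push_cast
    ring
  unfold ZpExtension.IsCyclotomic at hκ
  rw [hκ, Subgroup.mem_comap, CommGroup.mem_torsion] at hker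
  have hres : GaloisRep.cyclotomicCharacter ℚ p ρ = GaloisRep.cyclotomicCharacter (v.adicCompletion ℚ) p σ :=
    cyclotomicCharacter_absGaloisRestrict ℚ (v.adicCompletion ℚ) p σ
  refine ⟨(GaloisRep.cyclotomicCharacter ℚ p).toMonoidHom (ρ * (τ ^ p ^ m)⁻¹), GaloisRep.cyclotomicCharacter ℚ p τ, hker, ?_⟩
  rw [← hres, map_mul, map_inv, map_pow]
  change GaloisRep.cyclotomicCharacter ℚ p ρ =
    GaloisRep.cyclotomicCharacter ℚ p ρ * (GaloisRep.cyclotomicCharacter ℚ p τ ^ p ^ m)⁻¹ *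
      GaloisRep.cyclotomicCharacter ℚ p τ ^ p ^ m
  rw [inv_mul_cancel_right]

/-- **`χ(σ)^{p−1} ≡ 1 (mod p^{m+1})` for `σ ∈ H_m`, odd `p`**: `χ(σ) = ω w^{p^m}` with `ω^{p−1} = 1`, and
`(w^{p−1})^{p^m} ≡ 1` since `#(ℤ/p^{m+1})ˣ = (p−1)p^m`. [cite: Washington1997, §13.1] -/
theorem toZModPow_pow_cyclotomicCharacter_of_mem_layer (hp2 : p ≠ 2) (hκ : κ.IsCyclotomic)
    (v : HeightOneSpectrum (𝓞 ℚ)) {m : ℕ} {σ : absoluteGaloisGroup (v.adicCompletion ℚ)}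
    (hσ : σ ∈ localSubgroup (κ.layerSubgroup m) (v.adicCompletion ℚ)) :
    toZModPow (m + 1) (((GaloisRep.cyclotomicCharacter (v.adicCompletion ℚ) p σ : ℤ_[p]ˣ) : ℤ_[p]) ^ (p - 1)) = 1 := by
  obtain ⟨ω, w, hω, hχ⟩ := exists_cyclotomicCharacter_eq_of_mem_layer hκ v hσ
  -- `torsionOrder p = p - 1` for odd `p` (the tree's `Kato2004.torsionOrder_of_ne_two`, kept out of the import closure)
  have hτ : torsionOrder p = p - 1 := by
    have he : cyclotomicExponent p = 1 := by unfold cyclotomicExponent; simp [hp2]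
    rw [torsionOrder, he, pow_one, Nat.totient_prime hp.out]
  have hω1 : ((ω : ℤ_[p])) ^ (p - 1) = 1 := by
    rw [← hτ]; exact pow_torsionOrder_eq_one_of_isOfFinOrder hω
  haveI : NeZero (p ^ (m + 1)) := ⟨pow_ne_zero _ hp.out.ne_zero⟩
  -- the unit `w̄ = w mod p^{m+1}` of `ℤ/p^{m+1}` has `w̄^{(p-1)p^m} = 1`
  set wbar : (ZMod (p ^ (m + 1)))ˣ := Units.map (toZModPow (p := p) (m + 1)).toMonoidHom w with hwbar
  have hcard : Fintype.card (ZMod (p ^ (m + 1)))ˣ = (p - 1) * p ^ m := by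
    rw [ZMod.card_units_eq_totient, Nat.totient_prime_pow hp.out (by omega), Nat.add_sub_cancel, mul_comm]
  have hw1 : (wbar : ZMod (p ^ (m + 1))) ^ ((p - 1) * p ^ m) = 1 := by
    rw [← hcard, ← Units.val_pow_eq_pow_val, pow_card_eq_one, Units.val_one]
  have hwval : (wbar : ZMod (p ^ (m + 1))) = toZModPow (m + 1) (w : ℤ_[p]) := rfl
  rw [hχ, Units.val_mul, mul_pow, hω1, one_mul, Units.val_pow_eq_pow_val, ← pow_mul, map_pow, ← hwval,
    mul_comm, hw1]

/-! ### The cyclotomic element `η_m = ∏_{t^{p−1} = 1} (1 − ζ^t)` lies in `F_m` -/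

/-- **`η_m ∈ F_m`** (odd `p`): for `ζ ∈ K̄_v` with `ζ^{p^{m+1}} = 1`, the product of the `1 − ζ^{t}` over the units `t` of
`ℤ/p^{m+1}` with `t^{p−1} = 1` is fixed by `H_m` — `σ ∈ H_m` acts by `ζ ↦ ζ^{χ̄(σ)}` with `χ̄(σ)^{p−1} = 1`, permuting the
factors. [cite: Washington1997, §13.1 and Lemma 1.4] -/
theorem prod_one_sub_pow_mem_fixedField_layer (hp2 : p ≠ 2) (hκ : κ.IsCyclotomic) (v : HeightOneSpectrum (𝓞 ℚ))
    (m : ℕ) {ζ : AlgebraicClosure (v.adicCompletion ℚ)} (hζ : ζ ^ p ^ (m + 1) = 1) :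
    (∏ t ∈ (Finset.univ.filter fun t : (ZMod (p ^ (m + 1)))ˣ ↦ t ^ (p - 1) = 1),
        (1 - ζ ^ ((t : ZMod (p ^ (m + 1))).val))) ∈
      IntermediateField.fixedField (localSubgroup (κ.layerSubgroup m) (v.adicCompletion ℚ)) := by
  haveI : CharZero (v.adicCompletion ℚ) :=
    charZero_of_injective_algebraMap (algebraMap ℚ (v.adicCompletion ℚ)).injective
  haveI : NeZero ((p : ℕ) : v.adicCompletion ℚ) := ⟨by exact_mod_cast hp.out.ne_zero⟩
  haveI : NeZero (p ^ (m + 1)) := ⟨pow_ne_zero _ hp.out.ne_zero⟩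
  set S : Finset (ZMod (p ^ (m + 1)))ˣ := Finset.univ.filter fun t : (ZMod (p ^ (m + 1)))ˣ ↦ t ^ (p - 1) = 1 with hS
  rw [IntermediateField.mem_fixedField_iff]
  intro σ hσ
  -- `σ ζ = ζ^{c}`, `c = χ̄(σ)`, `c^{p−1} = 1`
  set c : (ZMod (p ^ (m + 1)))ˣ :=
    Units.map (toZModPow (p := p) (m + 1)).toMonoidHom (GaloisRep.cyclotomicCharacter (v.adicCompletion ℚ) p σ) with hc
  have hcS : c ^ (p - 1) = 1 := by
    apply Units.ext
    rw [Units.val_pow_eq_pow_val, Units.val_one]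
    change toZModPow (m + 1) ((GaloisRep.cyclotomicCharacter (v.adicCompletion ℚ) p σ : ℤ_[p]ˣ) : ℤ_[p]) ^ (p - 1) = 1
    rw [← map_pow]
    exact toZModPow_pow_cyclotomicCharacter_of_mem_layer hp2 hκ v hσ
  have hσζ : σ • ζ = ζ ^ (c : ZMod (p ^ (m + 1))).val :=
    GaloisRep.cyclotomicCharacter_spec (v.adicCompletion ℚ) p (k := m + 1) σ ζ hζ
  -- the action on a factor: `σ (1 − ζ^{t}) = 1 − ζ^{(c t)}`
  have hpowmod : ∀ a b : ZMod (p ^ (m + 1)), (ζ ^ a.val) ^ b.val = ζ ^ (b * a).val := by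
    intro a b
    rw [← pow_mul, ZMod.val_mul, mul_comm a.val, pow_eq_pow_mod (b.val * a.val) hζ]
  have hfac : ∀ t : (ZMod (p ^ (m + 1)))ˣ,
      σ (1 - ζ ^ ((t : ZMod (p ^ (m + 1))).val)) = 1 - ζ ^ (((c * t : (ZMod (p ^ (m + 1)))ˣ) : ZMod (p ^ (m + 1))).val) := by
    intro t
    rw [map_sub, map_one, map_pow]
    change 1 - (σ • ζ) ^ _ = _
    rw [hσζ, hpowmod, Units.val_mul, mul_comm]
  -- left multiplication by `c` permutes `S`
  have hperm : ∀ t ∈ S, c * t ∈ S := fun t ht ↦ by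
    rw [hS, Finset.mem_filter] at ht ⊢
    exact ⟨Finset.mem_univ _, by rw [mul_pow, hcS, one_mul, ht.2]⟩
  have hgoal : σ (∏ t ∈ S, (1 - ζ ^ ((t : ZMod (p ^ (m + 1))).val))) =
      (∏ t ∈ S, (1 - ζ ^ ((t : ZMod (p ^ (m + 1))).val))) := by
    rw [map_prod, Finset.prod_congr rfl (fun t _ ↦ hfac t)]
    refine Finset.prod_bij' (fun t _ ↦ c * t) (fun t _ ↦ c⁻¹ * t) (fun t ht ↦ hperm t ht) ?_ ?_ ?_ ?_
    · intro t ht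
      rw [hS, Finset.mem_filter] at ht ⊢
      refine ⟨Finset.mem_univ _, ?_⟩
      rw [mul_pow, inv_pow, hcS, inv_one, one_mul, ht.2]
    · intro t _
      rw [inv_mul_cancel_left]
    · intro t _
      rw [mul_inv_cancel_left]
    · intro t _
      rfl
  exact hgoal

end Summit.BirchSwinnertonDyer.BirchSwinnertonDyer.Theorems.MultTowerSplitExact

end
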